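import Summits.Ventures.CertifiedQuantumChemistry.Rows.DeterminantEnergy
import HarnessLib

/-!
# Ventures/CertifiedQuantumChemistry — Rows/DeterminantEnergyTables.lean: one-pass kernel evaluation of `Model.detEnergy` on `Model.ofTables` literals

HONEST FRAMING (verbatim): certified bounds for a stated model Hamiltonian in a stated basis; not a
claim about the real molecule beyond that model.

PART 2 of var-1's offered `DeterminantEnergy.lean` (item 5 of its header): `Model.detEnergyTab` + `Model.detEnergy_ofTables :
keysIncreasing eT = true → (Model.ofTables k hT eT E).detEnergy α β = detEnergyTab k hT eT E α β` — each canonical ERI key receives the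
total weight of the `(p,p,r,r)` (direct) and `(p,r,r,p)` (exchange) index patterns that canonicalise to it, so a literal model of any size
is evaluated in ONE pass over its table (the closed form's `2k²` association-list look-ups die in the kernel on the `++`-assembled
`k ≥ 14` tables; measurements in var-1's DET-ENERGIES.md). Pairwise-distinct keys come from the one-pass strict-sortedness check
`keysIncreasing` (every tree table is written in increasing key order).

LANDED BY THE TYPER (pub-qchem-typer g3, 2026-08-21) from var-1's offer `HOME/pub-qchem-var/lean/detupper/` (DET-ENERGIES.md de176804…; RULINGS VAR1-16 (a) / TYP-10 (a)): bodies byte-identical to the offered file, split at the gate's 400-line limit, one-line docstrings added where the offer had none. WORDING (TYP-10 (b)): these determinant rows are 'kernel-proved single-determinant (HF-level) upper bounds for the stated literal model' once ref countersigns; nothing else changes.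
-/

namespace Summit.Ventures.CertifiedQuantumChemistry

open Matrix Finset
open Literature.MathematicalPhysics.QuantumLattice Literature.MathematicalPhysics.QuantumChemistry

namespace Model

variable {k : ℕ}

/-! ## Single-pass table fold (kernel entry point for `Model.ofTables` literals of any size)

For a literal model `Model.ofTables k hT eT ecore` the closed form above costs `2k²` look-ups in the
association list `eT`; in the kernel each look-up walks the (`++`-assembled) list, which is too slow
for the `k = 14, 20, 28` tables.  `detEnergyTab` computes the same number in ONE pass over `eT`:
each canonical key `((a,b),(c,d))` receives the total weight of the index patterns `(p,p,r,r)`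
(direct) and `(p,r,r,p)` (exchange) that canonicalise to it.  Soundness needs the keys of `eT` to be
pairwise distinct, which we obtain from a one-pass strict-sortedness check `keysIncreasing eT = true`
(all tree tables are written in increasing key order). -/

section TableFold

/-- Values of `A` at natural-number indices (zero outside `Fin k`). -/
def extend2 (A : Fin k → Fin k → ℚ) (a c : ℕ) : ℚ :=
  if ha : a < k then (if hc : c < k then A ⟨a, ha⟩ ⟨c, hc⟩ else 0) else 0

/-- Total weight of the direct pattern `(p,p,r,r)` on the canonical key `κ`. -/
def wDirect (A : Fin k → Fin k → ℚ) (κ : (ℕ × ℕ) × (ℕ × ℕ)) : ℚ :=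
  if κ.1.1 = κ.1.2 ∧ κ.2.1 = κ.2.2 ∧ κ.1.1 ≤ κ.2.1 then
    extend2 A κ.1.1 κ.2.1 + (if κ.1.1 = κ.2.1 then 0 else extend2 A κ.2.1 κ.1.1)
  else 0

/-- Total weight of the exchange pattern `(p,r,r,p)` on the canonical key `κ`. -/
def wExchange (A : Fin k → Fin k → ℚ) (κ : (ℕ × ℕ) × (ℕ × ℕ)) : ℚ :=
  if κ.1.1 = κ.2.1 ∧ κ.1.2 = κ.2.2 ∧ κ.1.1 ≤ κ.1.2 then
    extend2 A κ.1.1 κ.1.2 + (if κ.1.1 = κ.1.2 then 0 else extend2 A κ.1.2 κ.1.1)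
  else 0

/-- Accumulating sum `acc + Σ_{e ∈ l} f e`; the `match` on the accumulator forces its evaluation at
every step, so the kernel never builds a deep unevaluated sum. -/
def sumAcc {E : Type*} (f : E → ℚ) : List E → ℚ → ℚ
  | [], acc => acc
  | e :: t, acc => match acc with
    | ⟨n, d, h1, h2⟩ => sumAcc f t (⟨n, d, h1, h2⟩ + f e)

/-- `sumAcc f l acc = acc + Σ (l.map f)` (the accumulator fold is the list sum). -/
theorem sumAcc_eq {E : Type*} (f : E → ℚ) : ∀ (l : List E) (acc : ℚ),
    sumAcc f l acc = acc + (l.map f).sum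
  | [], acc => by simp [sumAcc]
  | e :: t, acc => by
    obtain ⟨n, d, h1, h2⟩ := acc
    rw [sumAcc, sumAcc_eq f t, List.map_cons, List.sum_cons, add_assoc]

/-- **Single-pass determinant energy of a literal model** (`= detEnergy`, theorem
`detEnergy_ofTables`): one-body part by `k` look-ups in `hT`, two-body part by one traversal of `eT`. -/
def detEnergyTab (k : ℕ) (hT : List ((ℕ × ℕ) × (ℤ × ℕ)))
    (eT : List (((ℕ × ℕ) × (ℕ × ℕ)) × (ℤ × ℕ))) (ecore : ℚ) (α β : Finset (Fin k)) : ℚ :=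
  ∑ p : Fin k, ((hT.lookup (pairKey p.val p.val)).map entryVal).getD 0 * occNum α β p +
  (1 / 2 : ℚ) * sumAcc (fun e => entryVal e.2 *
      (wDirect (fun p r => occNum α β p * occNum α β r) e.1 - wExchange (pairNum α β) e.1)) eT 0 +
  ecore

/-- Strict lexicographic order on `ℕ × ℕ` (Bool). -/
def pairLT (x y : ℕ × ℕ) : Bool := decide (x.1 < y.1) || (decide (x.1 = y.1) && decide (x.2 < y.2))

/-- Strict lexicographic order on canonical ERI keys (Bool). -/
def keyLT (a b : (ℕ × ℕ) × (ℕ × ℕ)) : Bool := pairLT a.1 b.1 || (decide (a.1 = b.1) && pairLT a.2 b.2)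

/-- The keys of an association list are strictly increasing (one kernel pass). -/
def keysIncreasing {V : Type*} : List (((ℕ × ℕ) × (ℕ × ℕ)) × V) → Bool
  | [] => true
  | [_] => true
  | a :: b :: t => keyLT a.1 b.1 && keysIncreasing (b :: t)

/-- `keyLT` is transitive. -/
theorem keyLT_trans {a b c : (ℕ × ℕ) × (ℕ × ℕ)} (hab : keyLT a b = true) (hbc : keyLT b c = true) :
    keyLT a c = true := by
  obtain ⟨⟨a1, a2⟩, ⟨a3, a4⟩⟩ := a
  obtain ⟨⟨b1, b2⟩, ⟨b3, b4⟩⟩ := b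
  obtain ⟨⟨c1, c2⟩, ⟨c3, c4⟩⟩ := c
  simp only [keyLT, pairLT, Bool.or_eq_true, Bool.and_eq_true, decide_eq_true_eq, Prod.mk.injEq] at hab hbc ⊢
  omega

/-- `keyLT a b` forces `a ≠ b` (strict order). -/
theorem ne_of_keyLT {a b : (ℕ × ℕ) × (ℕ × ℕ)} (hab : keyLT a b = true) : a ≠ b := by
  rintro rfl
  obtain ⟨⟨a1, a2⟩, ⟨a3, a4⟩⟩ := a
  simp only [keyLT, pairLT, Bool.or_eq_true, Bool.and_eq_true, decide_eq_true_eq] at hab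
  omega

/-- Unfolding `keysIncreasing` at a cons: the head key is below every later key and the tail is increasing. -/
theorem keysIncreasing_cons {V : Type*} (a : ((ℕ × ℕ) × (ℕ × ℕ)) × V) :
    ∀ (t : List (((ℕ × ℕ) × (ℕ × ℕ)) × V)), keysIncreasing (a :: t) = true →
      (∀ b ∈ t, keyLT a.1 b.1 = true) ∧ keysIncreasing t = true
  | [], _ => by simp [keysIncreasing]
  | b :: t, h => by
    simp only [keysIncreasing, Bool.and_eq_true] at h
    obtain ⟨hab, ht⟩ := h
    have ih := keysIncreasing_cons b t ht
    refine ⟨fun c hc => ?_, ht⟩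
    rcases List.mem_cons.mp hc with rfl | hc
    · exact hab
    · exact keyLT_trans hab (ih.1 c hc)

/-- A strictly key-increasing association list has pairwise-distinct keys. -/
theorem nodup_keys_of_increasing {V : Type*} :
    ∀ (l : List (((ℕ × ℕ) × (ℕ × ℕ)) × V)), keysIncreasing l = true → (l.map Prod.fst).Nodup
  | [], _ => List.nodup_nil
  | a :: t, h => by
    obtain ⟨hall, ht⟩ := keysIncreasing_cons a t h
    rw [List.map_cons, List.nodup_cons]
    refine ⟨fun hmem => ?_, nodup_keys_of_increasing t ht⟩
    obtain ⟨b, hb, hba⟩ := List.mem_map.mp hmem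
    exact ne_of_keyLT (hall b hb) hba.symm

/-- With pairwise-distinct keys, a defaulted look-up is the sum of the matching entries. -/
theorem lookup_getD_eq_sum {K V : Type*} [BEq K] [LawfulBEq K] [DecidableEq K] (val : V → ℚ) :
    ∀ (l : List (K × V)) (κ : K), (l.map Prod.fst).Nodup →
      ((l.lookup κ).map val).getD 0 = (l.map fun e => if e.1 = κ then val e.2 else 0).sum
  | [], κ, _ => by simp
  | e :: t, κ, hnd => by
    rw [List.map_cons, List.nodup_cons] at hnd
    obtain ⟨k', v⟩ := e
    rw [List.lookup_cons, List.map_cons, List.sum_cons]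
    by_cases h : κ = k'
    · subst h
      have htail : (t.map fun e => if e.1 = κ then val e.2 else 0).sum = 0 := by
        refine List.sum_eq_zero ?_
        intro x hx
        obtain ⟨y, hy, rfl⟩ := List.mem_map.mp hx
        exact if_neg fun hyk => hnd.1 (List.mem_map.mpr ⟨y, hy, hyk⟩)
      simp [htail]
    · have hb : (κ == k') = false := beq_eq_false_iff_ne.mpr h
      simp only [hb, if_neg (Ne.symm h), zero_add]
      exact lookup_getD_eq_sum val t κ hnd.2

/-- Swapping a finite sum with a list sum. -/
theorem finset_sum_list_sum {X E : Type*} (S : Finset X) (f : X → E → ℚ) :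
    ∀ (l : List E), ∑ x ∈ S, (l.map (fun e => f x e)).sum = (l.map fun e => ∑ x ∈ S, f x e).sum
  | [] => by simp
  | e :: t => by
    simp only [List.map_cons, List.sum_cons, Finset.sum_add_distrib, finset_sum_list_sum S f t]

/-- `Σ f − Σ g = Σ (f − g)` over a list. -/
theorem list_sum_sub {E : Type*} (f g : E → ℚ) :
    ∀ (l : List E), (l.map f).sum - (l.map g).sum = (l.map fun e => f e - g e).sum
  | [] => by simp
  | e :: t => by
    rw [List.map_cons, List.map_cons, List.map_cons, List.sum_cons, List.sum_cons, List.sum_cons,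
      ← list_sum_sub f g t]
    ring

/-- `(Σ f) · c = Σ (f · c)` over a list. -/
theorem list_sum_mul {E : Type*} (f : E → ℚ) (c : ℚ) :
    ∀ (l : List E), (l.map f).sum * c = (l.map fun e => f e * c).sum
  | [] => by simp
  | e :: t => by rw [List.map_cons, List.sum_cons, add_mul, list_sum_mul f c t, List.map_cons, List.sum_cons]

/-- Picking an index by its value. -/
theorem sum_ite_val_eq (a : ℕ) (f : Fin k → ℚ) :
    ∑ p : Fin k, (if (p : ℕ) = a then f p else 0) = if h : a < k then f ⟨a, h⟩ else 0 := by
  by_cases h : a < k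
  · rw [dif_pos h]
    have : ∀ p : Fin k, ((p : ℕ) = a) = (p = ⟨a, h⟩) := fun p => by rw [Fin.ext_iff]
    simp_rw [this, Finset.sum_ite_eq', Finset.mem_univ, if_true]
  · rw [dif_neg h]
    refine Finset.sum_eq_zero fun p _ => ?_
    rw [if_neg]
    intro hp
    exact h (hp ▸ p.isLt)

/-- The double indicator sum over `Fin k × Fin k` picking `(a, c)` is `extend2 A a c`. -/
theorem sum_sum_ite_val_eq (a c : ℕ) (A : Fin k → Fin k → ℚ) :
    ∑ p : Fin k, ∑ r : Fin k, (if (p : ℕ) = a ∧ (r : ℕ) = c then A p r else 0) = extend2 A a c := by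
  simp only [ite_and, Finset.sum_ite_irrel, Finset.sum_const_zero, sum_ite_val_eq]
  unfold extend2
  by_cases ha : a < k
  · simp only [dif_pos ha]
  · simp only [dif_neg ha]

/-- The fibre of the direct pattern over a canonical key. -/
theorem quadKey_pprr_eq_iff (p r a b c d : ℕ) :
    quadKey p p r r = ((a, b), (c, d)) ↔ (a = b ∧ c = d ∧ a ≤ c) ∧ (p = a ∧ r = c ∨ p = c ∧ r = a) := by
  unfold quadKey pairKey pairLE
  simp only [le_refl, ↓reduceIte, Bool.or_eq_true, Bool.and_eq_true, decide_eq_true_eq]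
  split_ifs with h <;> simp only [Prod.mk.injEq] <;> omega

/-- The fibre of the exchange pattern over a canonical key. -/
theorem quadKey_prrp_eq_iff (p r a b c d : ℕ) :
    quadKey p r r p = ((a, b), (c, d)) ↔ (a = c ∧ b = d ∧ a ≤ b) ∧ (p = a ∧ r = b ∨ p = b ∧ r = a) := by
  unfold quadKey pairKey pairLE
  by_cases h1 : p ≤ r <;> by_cases h2 : r ≤ p <;>
    simp only [h1, h2, ↓reduceIte, Bool.or_eq_true, Bool.and_eq_true, decide_eq_true_eq] <;>
    split_ifs <;> simp only [Prod.mk.injEq] <;> omega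

/-- For `a ≠ c` the indicator of `{(a,c), (c,a)}` sums to `extend2 A a c + extend2 A c a`. -/
theorem sum_ite_or_disjoint (a c : ℕ) (hac : a ≠ c) (A : Fin k → Fin k → ℚ) :
    ∑ p : Fin k, ∑ r : Fin k,
        (if ((p : ℕ) = a ∧ (r : ℕ) = c) ∨ ((p : ℕ) = c ∧ (r : ℕ) = a) then A p r else 0) =
      extend2 A a c + extend2 A c a := by
  have hsplit : ∀ (p r : Fin k),
      (if ((p : ℕ) = a ∧ (r : ℕ) = c) ∨ ((p : ℕ) = c ∧ (r : ℕ) = a) then A p r else 0) =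
        (if ((p : ℕ) = a ∧ (r : ℕ) = c) then A p r else 0) +
        (if ((p : ℕ) = c ∧ (r : ℕ) = a) then A p r else 0) := by
    intro p r
    by_cases h1 : ((p : ℕ) = a ∧ (r : ℕ) = c)
    · have h2 : ¬((p : ℕ) = c ∧ (r : ℕ) = a) := fun h2 => hac (h1.1.symm.trans h2.1)
      rw [if_pos (Or.inl h1), if_pos h1, if_neg h2, add_zero]
    · by_cases h2 : ((p : ℕ) = c ∧ (r : ℕ) = a)
      · rw [if_pos (Or.inr h2), if_neg h1, if_pos h2, zero_add]
      · rw [if_neg h1, if_neg h2, add_zero, if_neg (fun h => h.elim h1 h2)]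
  simp_rw [hsplit, Finset.sum_add_distrib, sum_sum_ite_val_eq]

/-- Fibre of the direct pattern `(p,p,r,r)` over one canonical key: total weight `v · wDirect A κ`. -/
theorem fiber_direct (v : ℚ) (A : Fin k → Fin k → ℚ) (κ : (ℕ × ℕ) × (ℕ × ℕ)) :
    ∑ p : Fin k, ∑ r : Fin k, (if κ = quadKey p p r r then v else 0) * A p r = v * wDirect A κ := by
  obtain ⟨⟨a, b⟩, ⟨c, d⟩⟩ := κ
  have hrw : ∀ p r : Fin k, (if ((a, b), (c, d)) = quadKey p p r r then v else 0) * A p r =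
      v * (if (a = b ∧ c = d ∧ a ≤ c) ∧ ((p : ℕ) = a ∧ (r : ℕ) = c ∨ (p : ℕ) = c ∧ (r : ℕ) = a)
            then A p r else 0) := by
    intro p r
    have hiff : (((a, b), (c, d)) = quadKey (p : ℕ) p r r) ↔
        (a = b ∧ c = d ∧ a ≤ c) ∧ ((p : ℕ) = a ∧ (r : ℕ) = c ∨ (p : ℕ) = c ∧ (r : ℕ) = a) := by
      rw [eq_comm]; exact quadKey_pprr_eq_iff _ _ _ _ _ _
    simp only [hiff]
    split_ifs <;> ring
  simp_rw [hrw, ← Finset.mul_sum]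
  congr 1
  unfold wDirect
  by_cases hc : (a = b ∧ c = d ∧ a ≤ c)
  · rw [if_pos hc]
    obtain ⟨rfl, rfl, hle⟩ := hc
    simp only [hle, true_and, and_self]
    by_cases hac : a = c
    · subst hac
      simp only [or_self, if_true, add_zero, sum_sum_ite_val_eq]
    · rw [if_neg hac, sum_ite_or_disjoint a c hac A]
  · simp only [hc, false_and, if_false, Finset.sum_const_zero]

/-- Fibre of the exchange pattern `(p,r,r,p)` over one canonical key: total weight `v · wExchange A κ`. -/
theorem fiber_exchange (v : ℚ) (A : Fin k → Fin k → ℚ) (κ : (ℕ × ℕ) × (ℕ × ℕ)) :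
    ∑ p : Fin k, ∑ r : Fin k, (if κ = quadKey p r r p then v else 0) * A p r = v * wExchange A κ := by
  obtain ⟨⟨a, b⟩, ⟨c, d⟩⟩ := κ
  have hrw : ∀ p r : Fin k, (if ((a, b), (c, d)) = quadKey p r r p then v else 0) * A p r =
      v * (if (a = c ∧ b = d ∧ a ≤ b) ∧ ((p : ℕ) = a ∧ (r : ℕ) = b ∨ (p : ℕ) = b ∧ (r : ℕ) = a)
            then A p r else 0) := by
    intro p r
    have hiff : (((a, b), (c, d)) = quadKey (p : ℕ) r r p) ↔
        (a = c ∧ b = d ∧ a ≤ b) ∧ ((p : ℕ) = a ∧ (r : ℕ) = b ∨ (p : ℕ) = b ∧ (r : ℕ) = a) := by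
      rw [eq_comm]; exact quadKey_prrp_eq_iff _ _ _ _ _ _
    simp only [hiff]
    split_ifs <;> ring
  simp_rw [hrw, ← Finset.mul_sum]
  congr 1
  unfold wExchange
  by_cases hc : (a = c ∧ b = d ∧ a ≤ b)
  · rw [if_pos hc]
    obtain ⟨rfl, rfl, hle⟩ := hc
    simp only [hle, true_and, and_self]
    by_cases hab : a = b
    · subst hab
      simp only [or_self, if_true, add_zero, sum_sum_ite_val_eq]
    · rw [if_neg hab, sum_ite_or_disjoint a b hab A]
  · simp only [hc, false_and, if_false, Finset.sum_const_zero]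

/-- **`detEnergy` of a literal model in one pass over its ERI table.** -/
theorem detEnergy_ofTables (k : ℕ) (hT : List ((ℕ × ℕ) × (ℤ × ℕ)))
    (eT : List (((ℕ × ℕ) × (ℕ × ℕ)) × (ℤ × ℕ))) (ecore : ℚ) (α β : Finset (Fin k))
    (hinc : keysIncreasing eT = true) :
    (Model.ofTables k hT eT ecore).detEnergy α β = detEnergyTab k hT eT ecore α β := by
  have hnd : (eT.map Prod.fst).Nodup := nodup_keys_of_increasing eT hinc
  unfold detEnergy detEnergyTab
  simp only [Model.ofTables, sumAcc_eq, zero_add, Finset.sum_sub_distrib,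
    lookup_getD_eq_sum entryVal eT _ hnd, list_sum_mul, finset_sum_list_sum, fiber_direct,
    fiber_exchange, list_sum_sub, ← mul_sub]

end TableFold

end Model

end Summit.Ventures.CertifiedQuantumChemistry
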